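import Summits.Ventures.PercRepro.RankLevelSetUpClassBound

/-! # RankLevelSetUpInterval — THE INTERVAL FORM OF (↑) IN THE CHAIN REGIME: `T_k(b) ≤ T_j(b)` FOR EVERY
`k ≤ j ≤ #E − 1 − k`, AND ITS PAIR FORM (night-1 g40; dossier §52.21; on `RankLevelSetUpClassBound`)

The telescoping `le_of_chain` of the up-shadow steps `(#E − i − 2) · T_i ≤ i · T_{i+1}` (coloop bound `2` at the
levels `k … #E − 2 − k`) is not only `T_k ≤ T_{#E−1−k}` (that is (↑), `upAt_of_bound_two`) but `T_k ≤ T_j` for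
EVERY `j` with `k ≤ j ≤ #E − 1 − k` (**`through_le_through_of_bound_two`**): the through-`b` profile is at least
`T_k` on the whole reflected interval — in particular the two-step reflection (↑⁺)_k `T_k ≤ T_{#E−2−k}`
(**`upPlusAt_of_bound_two`**). The same for the pair profile (**`throughPair_le_throughPair_of_bound_two`**), and
the instances on coloop-free matroids of nullity `≤ 3` (every level) and of nullity `≤ 4` with all series classes
of `≤ k − 2` elements (**`through_le_through_of_nullity_three`**, **`through_le_through_of_class_le`**,
**`throughPair_le_throughPair_of_class_le`**). Every declaration has a docstring; imports: the cell's own modules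
and Mathlib only. Axioms: standard. -/

namespace PercRepro

open Set Matroid

variable {α : Type} (M : Matroid α) [M.Finite]

/-- **THE INTERVAL FORM FROM THE COLOOP BOUND `2`**: if every through-`b` member `W` at the levels
`k ≤ i ≤ #E − 2 − k` has at most `2` elements of `E ∖ W` in `cl W`, then `T_k ≤ T_j` for every `k ≤ j ≤ #E − 1 − k`
(`1 ≤ k`). -/
theorem through_le_through_of_bound_two {b : α} {k : ℕ} (hk1 : 1 ≤ k)
    (hbound : ∀ i, k ≤ i → i + k + 2 ≤ M.E.ncard →
      ∀ W ∈ biIndep M i, b ∈ W → {t ∈ M.E \ W | t ∈ M.closure W}.ncard ≤ 2)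
    {j : ℕ} (hkj : k ≤ j) (hj : j + k + 1 ≤ M.E.ncard) :
    {W ∈ biIndep M k | b ∈ W}.ncard ≤ {W ∈ biIndep M j | b ∈ W}.ncard := by
  let f : ℕ → ℕ := fun i => {W ∈ biIndep M (i + 1) | b ∈ W}.ncard
  have hstep : ∀ t, t < j - k →
      (M.E.ncard - k - 2 - t) * f (k - 1 + t) ≤ (k - 1 + t + 1) * f (k - 1 + t + 1) := by
    intro t ht
    have e1 : k - 1 + t + 1 = k + t := by omega
    have e2 : M.E.ncard - k - 2 - t = M.E.ncard - (k + t) - 2 := by omega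
    show (M.E.ncard - k - 2 - t) * {W ∈ biIndep M (k - 1 + t + 1) | b ∈ W}.ncard ≤
      (k - 1 + t + 1) * {W ∈ biIndep M (k - 1 + t + 1 + 1) | b ∈ W}.ncard
    rw [e1, e2]
    exact upFam_step M (b := b) (k := k + t) (c₀ := 2) (hbound (k + t) (by omega) (by omega))
  have hchain := le_of_chain f (a := k - 1) (c := M.E.ncard - k - 2) (m := j - k) (by omega) hstep
  have h1 : f (k - 1) = {W ∈ biIndep M k | b ∈ W}.ncard := by
    show {W ∈ biIndep M (k - 1 + 1) | b ∈ W}.ncard = _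
    rw [Nat.sub_add_cancel hk1]
  have h2 : f (k - 1 + (j - k)) = {W ∈ biIndep M j | b ∈ W}.ncard := by
    show {W ∈ biIndep M (k - 1 + (j - k) + 1) | b ∈ W}.ncard = _
    have e : k - 1 + (j - k) + 1 = j := by omega
    rw [e]
  rw [← h1, ← h2]
  exact hchain

/-- **THE TWO-STEP REFLECTION (↑⁺) FROM THE COLOOP BOUND `2`**: `T_k ≤ T_{#E−2−k}` (`1 ≤ k`, `2k + 3 ≤ #E`). -/
theorem upPlusAt_of_bound_two {b : α} {k : ℕ} (hk1 : 1 ≤ k) (hk : 2 * k + 3 ≤ M.E.ncard)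
    (hbound : ∀ i, k ≤ i → i + k + 2 ≤ M.E.ncard →
      ∀ W ∈ biIndep M i, b ∈ W → {t ∈ M.E \ W | t ∈ M.closure W}.ncard ≤ 2) :
    {W ∈ biIndep M k | b ∈ W}.ncard ≤ {W ∈ biIndep M (M.E.ncard - 2 - k) | b ∈ W}.ncard :=
  through_le_through_of_bound_two M hk1 hbound (by omega) (by omega)

/-- **THE INTERVAL FORM OF THE PAIR PROFILE FROM THE COLOOP BOUND `2`**: `T^{bc}_k ≤ T^{bc}_j` for every
`k ≤ j ≤ #E − 1 − k` (`2 ≤ k`). -/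
theorem throughPair_le_throughPair_of_bound_two {b c : α} (hbc : b ≠ c) {k : ℕ} (hk2 : 2 ≤ k)
    (hbound : ∀ i, k ≤ i → i + k + 2 ≤ M.E.ncard →
      ∀ W ∈ biIndep M i, b ∈ W → c ∈ W → {t ∈ M.E \ W | t ∈ M.closure W}.ncard ≤ 2)
    {j : ℕ} (hkj : k ≤ j) (hj : j + k + 1 ≤ M.E.ncard) :
    {W ∈ biIndep M k | b ∈ W ∧ c ∈ W}.ncard ≤ {W ∈ biIndep M j | b ∈ W ∧ c ∈ W}.ncard := by
  let f : ℕ → ℕ := fun i => {W ∈ biIndep M (i + 2) | b ∈ W ∧ c ∈ W}.ncard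
  have hstep : ∀ t, t < j - k →
      (M.E.ncard - k - 2 - t) * f (k - 2 + t) ≤ (k - 2 + t + 1) * f (k - 2 + t + 1) := by
    intro t ht
    have e1 : k - 2 + t + 2 = k + t := by omega
    have e2 : k - 2 + t + 1 + 2 = k + t + 1 := by omega
    have e3 : k - 2 + t + 1 = k + t - 1 := by omega
    have e4 : M.E.ncard - k - 2 - t = M.E.ncard - (k + t) - 2 := by omega
    show (M.E.ncard - k - 2 - t) * {W ∈ biIndep M (k - 2 + t + 2) | b ∈ W ∧ c ∈ W}.ncard ≤
      (k - 2 + t + 1) * {W ∈ biIndep M (k - 2 + t + 1 + 2) | b ∈ W ∧ c ∈ W}.ncard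
    rw [e1, e2, e3, e4]
    exact upPairFam_step M hbc (k := k + t) (c₀ := 2) (hbound (k + t) (by omega) (by omega))
  have hchain := le_of_chain f (a := k - 2) (c := M.E.ncard - k - 2) (m := j - k) (by omega) hstep
  have h1 : f (k - 2) = {W ∈ biIndep M k | b ∈ W ∧ c ∈ W}.ncard := by
    show {W ∈ biIndep M (k - 2 + 2) | b ∈ W ∧ c ∈ W}.ncard = _
    rw [Nat.sub_add_cancel hk2]
  have h2 : f (k - 2 + (j - k)) = {W ∈ biIndep M j | b ∈ W ∧ c ∈ W}.ncard := by
    show {W ∈ biIndep M (k - 2 + (j - k) + 2) | b ∈ W ∧ c ∈ W}.ncard = _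
    have e : k - 2 + (j - k) + 2 = j := by omega
    rw [e]
  rw [← h1, ← h2]
  exact hchain

/-- **THE INTERVAL FORM ON A COLOOP-FREE MATROID OF NULLITY `≤ 3`** (`2 ≤ k ≤ j ≤ #E − 1 − k`). -/
theorem through_le_through_of_nullity_three (hcol : ∀ e, ¬ M.IsColoop e) (hν : M✶.eRank ≤ 3) (b : α) {k : ℕ}
    (hk2 : 2 ≤ k) {j : ℕ} (hkj : k ≤ j) (hj : j + k + 1 ≤ M.E.ncard) :
    {W ∈ biIndep M k | b ∈ W}.ncard ≤ {W ∈ biIndep M j | b ∈ W}.ncard :=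
  through_le_through_of_bound_two M (by omega)
    (fun i _ hi W hW _ => bound_two_of_nullity_three M hcol hν hW (by omega)) hkj hj

/-- **THE INTERVAL FORM ON A COLOOP-FREE MATROID OF NULLITY `≤ 4` ALL OF WHOSE SERIES CLASSES HAVE `≤ k − 2`
ELEMENTS** (`4 ≤ k ≤ j ≤ #E − 1 − k`). -/
theorem through_le_through_of_class_le (hcol : ∀ e, ¬ M.IsColoop e) (hν : M✶.eRank ≤ 4) (b : α) {k : ℕ}
    (hk4 : 4 ≤ k) (hcls : ∀ e ∈ M.E, (M✶.closure {e}).ncard ≤ k - 2) {j : ℕ} (hkj : k ≤ j)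
    (hj : j + k + 1 ≤ M.E.ncard) :
    {W ∈ biIndep M k | b ∈ W}.ncard ≤ {W ∈ biIndep M j | b ∈ W}.ncard :=
  through_le_through_of_bound_two M (by omega)
    (fun i _ hi W hW _ => bound_two_of_class_le M hcol hν (by omega) hcls hW (by omega)) hkj hj

/-- **THE INTERVAL FORM OF THE PAIR PROFILE ON A COLOOP-FREE MATROID OF NULLITY `≤ 4` ALL OF WHOSE SERIES CLASSES
HAVE `≤ k − 2` ELEMENTS** (`4 ≤ k ≤ j ≤ #E − 1 − k`). -/
theorem throughPair_le_throughPair_of_class_le (hcol : ∀ e, ¬ M.IsColoop e) (hν : M✶.eRank ≤ 4) {b c : α}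
    (hbc : b ≠ c) {k : ℕ} (hk4 : 4 ≤ k) (hcls : ∀ e ∈ M.E, (M✶.closure {e}).ncard ≤ k - 2) {j : ℕ} (hkj : k ≤ j)
    (hj : j + k + 1 ≤ M.E.ncard) :
    {W ∈ biIndep M k | b ∈ W ∧ c ∈ W}.ncard ≤ {W ∈ biIndep M j | b ∈ W ∧ c ∈ W}.ncard :=
  throughPair_le_throughPair_of_bound_two M hbc (by omega)
    (fun i _ hi W hW _ _ => bound_two_of_class_le M hcol hν (by omega) hcls hW (by omega)) hkj hj

end PercRepro
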